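import Summits.Langlands.Langlands.Theses.SchurParitySplit

/-!
# Route SchurParitySplit — Assembly

The assembly item (stmt-Langlands-27416) of the child route `SchurParitySplit` (decomp-langlands lens-5 gen 15; a gate-native D-0170
refining child: `--refines route-Langlands-SchurDefectSplit:SchurDefectLayerLifting`, edge split, depth 2, no FRAME item) for the
host crux SCH = `SchurDefectSplit.SchurDefectLayerLifting` (stmt-Langlands-27235):
`DyadicSchurLayerLifting → OddSchurLayerLifting → SchurDefectSplit.SchurDefectLayerLifting`.

This is literally the type of the route file's sorry-free deciding theorem `Summit.Langlands.Langlands.Theses.SchurParitySplit.closes`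
(one decidable case split on the bound prime, `ℓ = 2` ∣ `ℓ ≠ 2`).  Nothing here proves `Langlands` (nor SCH): the assembly records only
that the two cell items of the route, taken together, imply the host crux by name.
-/

set_option linter.dupNamespace false -- project-wide option (lakefile weak.linter.dupNamespace); `Summit.Langlands.Langlands` is the mandated namespace

namespace Summit.Langlands.Langlands.Theorems

/-- **Assembly of route SchurParitySplit** (stmt-Langlands-27416): `D → O → SchurDefectSplit.SchurDefectLayerLifting`.
Proof: unfold `Assembly` and apply the route's deciding theorem `Theses.SchurParitySplit.closes`. -/
theorem schurParitySplit_assembly_proof :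
    Summit.Langlands.Langlands.Theses.SchurParitySplit.Assembly := by
  unfold Summit.Langlands.Langlands.Theses.SchurParitySplit.Assembly
  exact Summit.Langlands.Langlands.Theses.SchurParitySplit.closes

end Summit.Langlands.Langlands.Theorems
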